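import Summits.HodgeConjecture.HodgeConjecture.Theses.TorelliForSymmetries
import Literature.AlgebraicGeometry.Motives.SegreEmbedding

/-!
# Birth skeleton (BC3) of the crux `MiddleInvolutions` — reflections decide, one storey up

Crux `stmt-HodgeConjecture-14418` of route `TorelliForSymmetries` (rank 5, the catch-all
complementary sector), decl
`Summit.HodgeConjecture.HodgeConjecture.Theses.TorelliForSymmetries.MiddleInvolutions`:
for every guarded Betti–Hodge datum `B` (comparison-compatible + Künneth–Hodge clause), every
smooth projective `Y/ℂ` of EVEN dimension `n + n` and every INVOLUTIVE endomorphism `φ` of the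
`B`-Hodge structure on the middle cohomology `H^{2n}_B(Y)`, some class in
`A^{n+n}(Y × Y) ⊗ ℚ` induces `φ` (Kleiman's pairing form).

## The seam (the route's own hinge, applied to `Y × Y`)

The route header proves the crux HC-complete by DOUBLING: the Künneth–Hodge clause turns `φ` into
a middle-degree Hodge class `u` on the even-dimensional square `Y × Y` (smooth projective of
dimension `(n+n)+(n+n)`, `IsSmoothProjective.tensor_holds`), and `HC(Y × Y, codim n+n)` makes `u`
algebraic. The route's thesis is that HC in a middle degree is DECIDED BY REFLECTIONS in Hodge
classes (item `ReflectionsDecide`, the reflection lemma, provable now). Hence the crux for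
involutions of `H^{2n}_B(Y)` follows from the REFLECTION case on the square:

* `stub_middleReflections` — **the open core, in the route's own currency**: for every guarded
  `B`, every smooth projective `Y` of even dimension `n + n`, every polarization `P` of
  `H^{2n}_B(Y)` and every Hodge class `v ∈ Hdgⁿ_B(Y)`, the `P`-reflection
  `s_v = id − (2/P(v,v))·P(·,v)·v` of `H^{2n}_B(Y)` is induced by a class in
  `A^{n+n}(Y × Y) ⊗ ℚ` — verbatim the hypothesis of `ReflectionsDecide` at `(Y, p = n)`, asserted
  for even-dimensional `Y` in the middle degree. It is the special case `φ = s_v` of the crux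
  (`s_v` is an involutive `B`-Hodge endomorphism: first Hodge–Riemann relation + `ℚv ⊆ Fⁿ`), so it
  is WEAKER-looking than the crux; the content of the skeleton is that it gives the crux back.
  Since `id` is induced by the diagonal (`WeilCohomology.exists_isInducedBy_id`), `s_v` is a
  correspondence iff the rank-one Hodge endomorphism `x ↦ P(x,v)·v` is, i.e. iff ONE decomposable
  Hodge class `v ⊠ v^∨_P` on `Y × Y` is algebraic: the index set shrinks from the 2-torsion of
  `Aut` of the Hodge structure to `Hdgⁿ_B(Y)` itself. HC-complete (by `ReflectionsDecide`), open.
* `stub_reflectionsDecide` — **the reflection lemma**, the route's support item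
  `ReflectionsDecide` (stmt-HodgeConjecture-11028) BY NAME: for any `B`, `X` smooth projective of
  dimension `N`, `p`, and polarization `P` of `H^{2p}_B(X)`, if every `P`-reflection in a Hodge
  class is induced by a class in `A^N(X × X) ⊗ ℚ` then `B.HodgeConjectureFor hX p`
  (`P(v,v) > 0` by Hodge–Riemann, `ηᵖ` algebraic, correspondences preserve rational algebraic
  classes, `s_v(ηᵖ) = ηᵖ − c·v`). Provable now (M-sized); used here at `X = Y × Y`, `p = n + n`.
* `MiddleInvolutions_of` (no `sorry`): guard ⟹ Hodge class `u` on `Y × Y` inducing `φ`;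
  `tensor_holds` ⟹ `Y × Y` smooth projective of dimension `(n+n)+(n+n)`; `B.polarizable` ⟹ a
  polarization of `H^{2(n+n)}_B(Y × Y)`; stub 1 at `Y × Y` feeds stub 2 at `(Y × Y, p = n+n)` ⟹
  `B.HodgeConjectureFor hYY (n+n)`, i.e. `Hdg = ℚ·A`, so `u ∈ ℚ·A^{n+n}(Y × Y) ⊆ A^{n+n} ⊗ ℚ`
  (`mem_ratAlgebraicClasses_of_mem_algebraicClasses`, the divisible hull contains the `ℚ`-span,
  proved below). Concludes the route decl BY NAME. Involutivity of `φ` is not used by the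
  composition (as in the refuter's `middleInvolutions_of_hodgeConjecture`, evidence 2026-08-16):
  the doubling makes every Hodge endomorphism a middle Hodge class.

Neither stub alone is cheaply the crux or the summit (BC3 probes in the sibling file
`MiddleInvolutions_birth_probes.lean`, all failing): stub 1 speaks of reflections on `Y`, the
crux of arbitrary involutions — passing from one to the other needs the square, the polarization
and the reflection lemma; stub 2 is a provable lemma. `sorry` occurs only inside the two `stub_*`.
-/

set_option linter.dupNamespace false

namespace Summit.HodgeConjecture.HodgeConjecture.Cruxes.MiddleInvolutions.Birth

open Literature.AlgebraicGeometry.Motives CategoryTheory MonoidalCategory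
open Summit.HodgeConjecture.HodgeConjecture.Theses.TorelliForSymmetries

/-! ## A lemma of the glue (proved): the `ℚ`-span of the algebraic lattice lies in its divisible hull -/

/-- For a Weil cohomology with `ℚ`-coefficients, `ℚ · Aᵖ(X) ⊆ Aᵖ(X) ⊗ ℚ`: an element of the
`ℚ`-span of the algebraic lattice has a nonzero integer multiple in the lattice (the converse
inclusion is `ratAlgebraicClasses_le_algebraicClasses`). [cite: Kleiman1968, §1.4] -/
theorem mem_ratAlgebraicClasses_of_mem_algebraicClasses {k : Type*} [Field k]
    (W : WeilCohomology k ℚ) (X : SchemeOver k) (p : ℕ) {x : W.obj X (2 * p)}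
    (hx : x ∈ W.algebraicClasses X p) : x ∈ W.ratAlgebraicClasses X p := by
  change x ∈ Submodule.span ℚ (W.algebraicLattice X p : Set (W.obj X (2 * p))) at hx
  induction hx using Submodule.span_induction with
  | mem y hy => exact W.algebraicLattice_le_ratAlgebraicClasses X p hy
  | zero => exact zero_mem _
  | add y z _ _ hy hz => exact add_mem hy hz
  | smul q y _ hy =>
    -- `q • y` has the nonzero integer multiple `(N·den q) • (q • y) = num q • (N • y)` in `Aᵖ(X)`
    obtain ⟨N, hN, hNy⟩ := hy
    refine ⟨N * q.den, mul_ne_zero hN (by exact_mod_cast q.den_ne_zero), ?_⟩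
    have h : (N * (q.den : ℤ)) • (q • y) = q.num • (N • y) := by
      rw [← Int.cast_smul_eq_zsmul ℚ (N * (q.den : ℤ)) (q • y), ← Int.cast_smul_eq_zsmul ℚ N y,
        ← Int.cast_smul_eq_zsmul ℚ q.num _, smul_smul, smul_smul]
      congr 1
      push_cast
      rw [mul_assoc, Rat.den_mul_eq_num]
      ring
    rw [h]
    exact AddSubgroup.zsmul_mem _ hNy _

/-! ## The two registered stubs -/

/-- **Stub 1 — reflections in middle Hodge classes on even-dimensional varieties are
correspondences** (the open core): for every comparison-compatible `B` satisfying the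
Künneth–Hodge clause, every smooth projective `Y` of dimension `n + n`, every polarization `P` of
the `B`-Hodge structure `H^{2n}_B(Y)` and every Hodge class `v ∈ Hdgⁿ_B(Y)`, the `P`-reflection
`x ↦ x − (2/P(v,v))·P(x,v)·v` is induced on `H^{2n}_B(Y)` by some class in `A^{n+n}(Y × Y) ⊗ ℚ`
(pairing form, for all `j'` with `2n + j' = 2(n+n)`). The special case `φ = s_v` of the crux;
HC-complete through `ReflectionsDecide`. [cite: VoisinHodgeI2002, Lemma 11.41 and §11.3.3]
[cite: Kleiman1968, §1.3] -/
theorem stub_middleReflections :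
    ∀ B : BettiHodgeData ℂ, B.IsComparisonCompatible →
      (∀ ⦃n : ℕ⦄ ⦃X : SchemeOver ℂ⦄ (hX : IsSmoothProjective n X)
          (hXX : IsSmoothProjective (n + n) (X ⊗ X)) (i j' : ℕ) (hj : i + j' = 2 * n)
          (φ : HodgeStructure.Hom (B.hodge hX i) (B.hodge hX i)),
          ∃ u ∈ (B.hodge hXX (2 * n)).hodgeClasses (n : ℤ),
            B.W.IsInducedBy n n u φ.toLinearMap hj (show i + 2 * n + j' = 2 * (n + n) by omega)) →
      ∀ ⦃n : ℕ⦄ ⦃Y : SchemeOver ℂ⦄ (hY : IsSmoothProjective (n + n) Y)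
        (P : (B.hodge hY (2 * n)).Polarization),
        ∀ v ∈ (B.hodge hY (2 * n)).hodgeClasses (n : ℤ),
          ∀ (j' : ℕ) (hj : 2 * n + j' = 2 * (n + n)),
            ∃ u ∈ B.W.ratAlgebraicClasses (Y ⊗ Y) (n + n),
              B.W.IsInducedBy (n + n) (n + n) u
                (LinearMap.id - (P.form.flip v).smulRight ((2 / P.form v v) • v) :
                  B.W.obj Y (2 * n) →ₗ[ℚ] B.W.obj Y (2 * n))
                hj (show 2 * n + 2 * (n + n) + j' = 2 * ((n + n) + (n + n)) by omega) := by
  sorry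

/-- **Stub 2 — the reflection lemma** (the route's support item `ReflectionsDecide`,
stmt-HodgeConjecture-11028, by name): reflections in Hodge classes induced by rational algebraic
correspondences ⟹ `B.HodgeConjectureFor hX p`. Provable now from the `WeilCohomology` /
`BettiHodgeData` fields and `HodgeStructure.Polarization` (Hodge–Riemann positivity on the
`(p,p)`-piece, `ηᵖ` algebraic, `map_ratAlgebraicClasses_of_isInducedBy`).
[cite: Kleiman1968, §1.3] [cite: VoisinHodgeI2002, §11.3.3] -/
theorem stub_reflectionsDecide :
    Summit.HodgeConjecture.HodgeConjecture.Theses.TorelliForSymmetries.ReflectionsDecide := by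
  sorry

/-! ## The skeleton theorem -/

/-- **Composition (real proof) — THE SKELETON THEOREM.** Stub 1 (reflections on even-dimensional
varieties are correspondences) and stub 2 (`ReflectionsDecide`) imply the crux
`TorelliForSymmetries.MiddleInvolutions`, concluded BY NAME: for `φ` an endomorphism of the
`B`-Hodge structure `H^{2n}_B(Y)`, the Künneth–Hodge clause gives a Hodge class
`u ∈ Hdg^{n+n}_B(Y × Y)` inducing `φ`; `Y × Y` is smooth projective of dimension `(n+n)+(n+n)`
(`IsSmoothProjective.tensor_holds`); with a polarization of `H^{2(n+n)}_B(Y × Y)`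
(`B.polarizable`), stub 1 at `Y × Y` is exactly the hypothesis of stub 2 at `(Y × Y, p = n+n)`,
whence `B.HodgeConjectureFor hYY (n+n)`, `u ∈ ℚ·A^{n+n}(Y × Y)` (`hodgeConjectureFor_iff`) and
`u ∈ A^{n+n}(Y × Y) ⊗ ℚ` (`mem_ratAlgebraicClasses_of_mem_algebraicClasses`). -/
theorem MiddleInvolutions_of :
    (∀ B : BettiHodgeData ℂ, B.IsComparisonCompatible →
      (∀ ⦃n : ℕ⦄ ⦃X : SchemeOver ℂ⦄ (hX : IsSmoothProjective n X)
          (hXX : IsSmoothProjective (n + n) (X ⊗ X)) (i j' : ℕ) (hj : i + j' = 2 * n)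
          (φ : HodgeStructure.Hom (B.hodge hX i) (B.hodge hX i)),
          ∃ u ∈ (B.hodge hXX (2 * n)).hodgeClasses (n : ℤ),
            B.W.IsInducedBy n n u φ.toLinearMap hj (show i + 2 * n + j' = 2 * (n + n) by omega)) →
      ∀ ⦃n : ℕ⦄ ⦃Y : SchemeOver ℂ⦄ (hY : IsSmoothProjective (n + n) Y)
        (P : (B.hodge hY (2 * n)).Polarization),
        ∀ v ∈ (B.hodge hY (2 * n)).hodgeClasses (n : ℤ),
          ∀ (j' : ℕ) (hj : 2 * n + j' = 2 * (n + n)),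
            ∃ u ∈ B.W.ratAlgebraicClasses (Y ⊗ Y) (n + n),
              B.W.IsInducedBy (n + n) (n + n) u
                (LinearMap.id - (P.form.flip v).smulRight ((2 / P.form v v) • v) :
                  B.W.obj Y (2 * n) →ₗ[ℚ] B.W.obj Y (2 * n))
                hj (show 2 * n + 2 * (n + n) + j' = 2 * ((n + n) + (n + n)) by omega)) →
    Summit.HodgeConjecture.HodgeConjecture.Theses.TorelliForSymmetries.ReflectionsDecide →
    Summit.HodgeConjecture.HodgeConjecture.Theses.TorelliForSymmetries.MiddleInvolutions := by
  intro hR hD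
  unfold Summit.HodgeConjecture.HodgeConjecture.Theses.TorelliForSymmetries.MiddleInvolutions
  intro B hB K n Y hY φ _hφ j' hj
  -- the square `Y × Y` is smooth projective of dimension `(n+n)+(n+n)` (Segre)
  have hYY : IsSmoothProjective ((n + n) + (n + n)) (Y ⊗ Y) :=
    IsSmoothProjective.tensor_holds hY hY
  -- Künneth–Hodge clause: a middle-degree Hodge class on `Y × Y` inducing `φ`
  obtain ⟨u, hu, hind⟩ := K hY hYY (2 * n) j' hj φ
  -- a polarization of the middle cohomology of the square
  obtain ⟨P⟩ := B.polarizable hYY (2 * (n + n))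
  -- HC for `(Y × Y, n+n)`: the reflection lemma (stub 2) fed with stub 1 at `Y × Y`
  have hHC : B.HodgeConjectureFor hYY (n + n) :=
    hD B hYY (n + n) P (fun v hv j'' hj'' => hR B hB K hYY P v hv j'' hj'')
  -- so the Hodge class `u` is a rational algebraic class
  have hu' : u ∈ B.W.algebraicClasses (Y ⊗ Y) (n + n) :=
    (B.hodgeConjectureFor_iff hYY (n + n)).1 hHC hu
  exact ⟨u, mem_ratAlgebraicClasses_of_mem_algebraicClasses B.W (Y ⊗ Y) (n + n) hu', hind⟩

/-- **The crux from its registered stubs, by name** (no `sorry` of its own; closed modulo exactly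
the two `stub_*` placeholders — sanity check that the stubs compose). -/
theorem MiddleInvolutions_of_stubs :
    Summit.HodgeConjecture.HodgeConjecture.Theses.TorelliForSymmetries.MiddleInvolutions :=
  MiddleInvolutions_of stub_middleReflections stub_reflectionsDecide

end Summit.HodgeConjecture.HodgeConjecture.Cruxes.MiddleInvolutions.Birth
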